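import Literature.MathematicalPhysics.QuantumLattice.HubbardWave0RayleighProofs
import Literature.MathematicalPhysics.QuantumLattice.PairCorrelationsProofs

/-!
# Block modes: smeared CAR operators of a real orthonormal family along an injective orbital map

Support for the cruxes `NoInfraredPileUp` (stmt-HubbardSuperconductivity-18534) and
`NoNormalLimitState` (stmt-HubbardSuperconductivity-18533) of route `InfiniteVolumeFirst`: steps
S3+S4 of the coarse-tightness / atom-ceiling programme (`PLAN-coarse-tightness.md` attached to the
item) — the LOCAL (block) version of the pair Gram bounds of
`Literature/MathematicalPhysics/QuantumLattice/FreeFermiGasPairGramBounds.lean`, feeding the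
mesoscopic pair-order ceiling `(L²R⁴)⁻¹ Σ_a ‖B_a ψ‖²` of weak-coupling Hubbard ground states.

This file (1/4): for an injective orbital map `ω : U → ι` and a real family `φ : J → U → ℝ` with
orthonormal rows, the orbital functions `Function.extend ω φ_j 0` are orthonormal and the tree's
smeared operators (`RayleighBound.annihilate / create / numberMode`) of them are the BLOCK MODES
`c(φ_j) = Σ_u φ_j(u) c_{ω u}`; one-body and pair bilinear expansions under spectral hypotheses
`M = Σ_j λ_j φ_j φ_jᵀ`; the pair algebra `b_j† b_j = n_↓ n_↑`, `b_j b_j† = (1-n_↓)(1-n_↑)`,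
`[b_j†, b_{j'}] = 0`; and the block orbital maps `u ↦ (a + u, σ)` of the fermionic torus
(injective for `R ≤ L`, disjoint in the spin). Registered stub: `stub_coarseBlockModesPairExpansion`.

Sources: J. Bardeen, L. N. Cooper, J. R. Schrieffer, Phys. Rev. 108 (1957) 1175, §II;
C. N. Yang, Rev. Mod. Phys. 34 (1962) 694, §3; O. Bratteli, D. W. Robinson, *Operator Algebras and
Quantum Statistical Mechanics II* §5.2.2 (`a(f)`); D. J. Scalapino, Phys. Rep. 250 (1995) 329, §2.
Folklore finite-dimensional statements; no definition and no named fact is introduced.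
-/


noncomputable section

-- the mandated namespace `Summit.<Summit>.<Problem>.Theorems` repeats `HubbardSuperconductivity`
-- (single-problem summit, D-0017), which the `dupNamespace` linter flags on every declaration
set_option linter.dupNamespace false

namespace Summit.HubbardSuperconductivity.HubbardSuperconductivity.Theorems.CoarseTightness

open Literature.MathematicalPhysics.QuantumLattice Literature.Probability.LatticeModels Matrix Finset
open Literature.MathematicalPhysics.QuantumLattice.RayleighBound
open scoped ComplexConjugate ComplexOrder

/-! ### Orbital functions supported on the image of an injective map -/

section Extend

variable {ι : Type*} [LinearOrder ι] [Fintype ι] {U : Type*} [Fintype U] [DecidableEq U]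

omit [Fintype ι] in
/-- For injective `ω`, the extension by zero of `g` along `ω` is `o ↦ Σ_u [o = ω u] g u`. [folklore] -/
theorem extend_apply_eq_sum_ite {ω : U → ι} (hω : Function.Injective ω) (g : U → ℂ) (o : ι) :
    Function.extend ω g 0 o = ∑ u, if o = ω u then g u else 0 := by
  classical
  by_cases h : ∃ u, ω u = o
  · obtain ⟨u₀, rfl⟩ := h
    rw [hω.extend_apply]
    have : ∀ u, (ω u₀ = ω u) = (u₀ = u) := fun u => propext hω.eq_iff
    simp only [this, Finset.sum_ite_eq, Finset.mem_univ, if_true]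
  · rw [Function.extend_apply' _ _ _ h, Pi.zero_apply]
    refine (Finset.sum_eq_zero fun u _ => ?_).symm
    rw [if_neg fun hu => h ⟨u, hu.symm⟩]

/-- `c(extend ω g 0) = Σ_u conj(g u) • c_{ω u}` for injective `ω`. Bratteli–Robinson II §5.2.2
(`a(f)` is antilinear in `f`). [folklore] -/
theorem annihilate_extend_eq_sum {ω : U → ι} (hω : Function.Injective ω) (g : U → ℂ) :
    annihilate (Function.extend ω g 0) = ∑ u, star (g u) • annihilation (ω u) := by
  classical
  unfold annihilate
  simp_rw [extend_apply_eq_sum_ite hω g, star_sum, Finset.sum_smul]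
  rw [Finset.sum_comm]
  refine Finset.sum_congr rfl fun u _ => ?_
  simp only [apply_ite (star : ℂ → ℂ), star_zero, ite_smul, zero_smul, Finset.sum_ite_eq',
    Finset.mem_univ, if_true]

/-- `c†(extend ω g 0) = Σ_u g u • c†_{ω u}` for injective `ω`. Bratteli–Robinson II §5.2.2. [folklore] -/
theorem create_extend_eq_sum {ω : U → ι} (hω : Function.Injective ω) (g : U → ℂ) :
    create (Function.extend ω g 0) = ∑ u, g u • creation (ω u) := by
  rw [← annihilate_conjTranspose, annihilate_extend_eq_sum hω, conjTranspose_sum]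
  refine Finset.sum_congr rfl fun u _ => ?_
  rw [conjTranspose_smul, annihilation_conjTranspose, star_star]

/-- Inner product of two extensions along the same injective map:
`⟨extend ω g, extend ω g'⟩ = Σ_u conj(g u) g' u`. [folklore] -/
theorem star_extend_dotProduct_extend {ω : U → ι} (hω : Function.Injective ω) (g g' : U → ℂ) :
    star (Function.extend ω g 0) ⬝ᵥ Function.extend ω g' 0 = ∑ u, star (g u) * g' u := by
  classical
  simp only [dotProduct, Pi.star_apply]
  simp_rw [extend_apply_eq_sum_ite hω, star_sum, Finset.sum_mul, Finset.mul_sum]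
  rw [Finset.sum_comm]
  refine Finset.sum_congr rfl fun u _ => ?_
  rw [Finset.sum_comm]
  have h1 : ∀ v, ∑ o : ι, star (if o = ω u then g u else 0) * (if o = ω v then g' v else 0) =
      if u = v then star (g u) * g' u else 0 := by
    intro v
    rw [Finset.sum_eq_single (ω u)]
    · simp only [if_true]
      by_cases huv : u = v
      · subst huv; simp
      · rw [if_neg (fun h => huv (hω h)), if_neg huv, mul_zero]
    · intro o _ ho
      rw [if_neg ho, star_zero, zero_mul]
    · exact fun h => absurd (Finset.mem_univ _) h
  simp_rw [h1]
  simp only [Finset.sum_ite_eq, Finset.mem_univ, if_true]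

omit [DecidableEq U] in
/-- Extensions along maps with disjoint ranges are orthogonal. [folklore] -/
theorem star_extend_dotProduct_extend_of_disjoint {ω ω' : U → ι} (h : ∀ u v, ω u ≠ ω' v)
    (g g' : U → ℂ) : star (Function.extend ω g 0) ⬝ᵥ Function.extend ω' g' 0 = 0 := by
  classical
  simp only [dotProduct, Pi.star_apply]
  refine Finset.sum_eq_zero fun o _ => ?_
  by_cases ho : ∃ u, ω u = o
  · obtain ⟨u, rfl⟩ := ho
    rw [Function.extend_apply' _ _ _ (fun ⟨v, hv⟩ => h u v hv.symm), Pi.zero_apply, mul_zero]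
  · rw [Function.extend_apply' _ _ _ ho, Pi.zero_apply, star_zero, zero_mul]

end Extend

/-! ### Block modes of a real orthonormal family: orthonormality and bilinear expansions -/

section Modes

variable {ι : Type*} [LinearOrder ι] [Fintype ι] {U : Type*} [Fintype U] [DecidableEq U]
  {J : Type*} [Fintype J] [DecidableEq J]

omit [Fintype J] in
/-- Orthonormal rows of a real family give orthonormal extended orbital functions:
`⟨φ_j ∘ ω⁻¹, φ_{j'} ∘ ω⁻¹⟩ = δ_{jj'}`. [folklore] -/
theorem star_mode_dotProduct_mode {ω : U → ι} (hω : Function.Injective ω) (φ : J → U → ℝ)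
    (hON : ∀ j j', ∑ u, φ j u * φ j' u = if j = j' then 1 else 0) (j j' : J) :
    star (Function.extend ω (fun u => ((φ j u : ℝ) : ℂ)) 0) ⬝ᵥ
        Function.extend ω (fun u => ((φ j' u : ℝ) : ℂ)) 0 = if j = j' then 1 else 0 := by
  rw [star_extend_dotProduct_extend hω]
  simp only [Complex.star_def, Complex.conj_ofReal, ← Complex.ofReal_mul, ← Complex.ofReal_sum, hON]
  split_ifs <;> simp

omit [Fintype J] in
/-- The mode functions of a real orthonormal family are unit vectors. [folklore] -/
theorem star_mode_dotProduct_self {ω : U → ι} (hω : Function.Injective ω) (φ : J → U → ℝ)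
    (hON : ∀ j j', ∑ u, φ j u * φ j' u = if j = j' then 1 else 0) (j : J) :
    star (Function.extend ω (fun u => ((φ j u : ℝ) : ℂ)) 0) ⬝ᵥ
        Function.extend ω (fun u => ((φ j u : ℝ) : ℂ)) 0 = 1 := by
  rw [star_mode_dotProduct_mode hω φ hON, if_pos rfl]

omit [Fintype J] in
/-- Distinct modes of a real orthonormal family are orthogonal. [folklore] -/
theorem star_mode_dotProduct_of_ne {ω : U → ι} (hω : Function.Injective ω) (φ : J → U → ℝ)
    (hON : ∀ j j', ∑ u, φ j u * φ j' u = if j = j' then 1 else 0) {j j' : J} (h : j ≠ j') :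
    star (Function.extend ω (fun u => ((φ j u : ℝ) : ℂ)) 0) ⬝ᵥ
        Function.extend ω (fun u => ((φ j' u : ℝ) : ℂ)) 0 = 0 := by
  rw [star_mode_dotProduct_mode hω φ hON, if_neg h]

omit [DecidableEq J] in
/-- **One-body expansion.** If `M(u,v) = Σ_j λ_j φ_j(u) φ_j(v)` then
`Σ_{u,v} M(u,v) c†_{ω u} c_{ω v} = Σ_j λ_j n(φ_j)` (rotated number operators of the modes).
Bratteli–Robinson II §5.2.2. [folklore] -/
theorem sum_smul_creation_mul_annihilation_eq {ω : U → ι} (hω : Function.Injective ω)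
    (φ : J → U → ℝ) (M : U → U → ℝ) (lam : J → ℝ)
    (hM : ∀ u v, M u v = ∑ j, lam j * (φ j u * φ j v)) :
    ∑ u, ∑ v, (M u v : ℂ) • (creation (ω u) * annihilation (ω v)) =
      ∑ j, (lam j : ℂ) • numberMode (Function.extend ω (fun u => ((φ j u : ℝ) : ℂ)) 0) := by
  have h1 : ∀ j, numberMode (Function.extend ω (fun u => ((φ j u : ℝ) : ℂ)) 0) =
      ∑ u, ∑ v, ((φ j u : ℂ) * (φ j v : ℂ)) • (creation (ω u) * annihilation (ω v)) := fun j => by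
    rw [numberMode, create_extend_eq_sum hω, annihilate_extend_eq_sum hω, Finset.sum_mul_sum]
    refine Finset.sum_congr rfl fun u _ => Finset.sum_congr rfl fun v _ => ?_
    rw [smul_mul_smul_comm, Complex.star_def, Complex.conj_ofReal]
  simp_rw [h1, Finset.smul_sum, smul_smul]
  symm
  rw [Finset.sum_comm]
  refine Finset.sum_congr rfl fun u _ => ?_
  rw [Finset.sum_comm]
  refine Finset.sum_congr rfl fun v _ => ?_
  rw [← Finset.sum_smul, hM]
  push_cast
  rfl

omit [DecidableEq J] in
/-- **Pair expansion.** If `K(u,v) = Σ_j κ_j φ_j(u) φ_j(v)` then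
`Σ_{u,v} K(u,v) c_{ω↑ u} c_{ω↓ v} = Σ_j κ_j c_↑(φ_j) c_↓(φ_j)` (a perfect matching of the block
modes). Bardeen–Cooper–Schrieffer (1957) §II. [folklore] -/
theorem sum_smul_pair_eq {ωu ωd : U → ι} (hωu : Function.Injective ωu)
    (hωd : Function.Injective ωd) (φ : J → U → ℝ) (K : U → U → ℝ) (κ : J → ℝ)
    (hK : ∀ u v, K u v = ∑ j, κ j * (φ j u * φ j v)) :
    ∑ u, ∑ v, (K u v : ℂ) • (annihilation (ωu u) * annihilation (ωd v)) =
      ∑ j, (κ j : ℂ) • (annihilate (Function.extend ωu (fun u => ((φ j u : ℝ) : ℂ)) 0) *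
        annihilate (Function.extend ωd (fun u => ((φ j u : ℝ) : ℂ)) 0)) := by
  have h1 : ∀ j, annihilate (Function.extend ωu (fun u => ((φ j u : ℝ) : ℂ)) 0) *
        annihilate (Function.extend ωd (fun u => ((φ j u : ℝ) : ℂ)) 0) =
      ∑ u, ∑ v, ((φ j u : ℂ) * (φ j v : ℂ)) • (annihilation (ωu u) * annihilation (ωd v)) :=
    fun j => by
    rw [annihilate_extend_eq_sum hωu, annihilate_extend_eq_sum hωd, Finset.sum_mul_sum]
    refine Finset.sum_congr rfl fun u _ => Finset.sum_congr rfl fun v _ => ?_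
    simp only [smul_mul_smul_comm, Complex.star_def, Complex.conj_ofReal]
  simp_rw [h1, Finset.smul_sum, smul_smul]
  symm
  rw [Finset.sum_comm]
  refine Finset.sum_congr rfl fun u _ => ?_
  rw [Finset.sum_comm]
  refine Finset.sum_congr rfl fun v _ => ?_
  rw [← Finset.sum_smul, hK]
  push_cast
  rfl

end Modes

/-! ### The pair algebra of the block modes -/

section PairAlgebra

variable {ι : Type*} [LinearOrder ι] [Fintype ι] {U : Type*} [Fintype U] [DecidableEq U]
  {J : Type*} [DecidableEq J]

/-- Four pairwise anticommuting factors: `(XY)(PQ) = (PQ)(XY)` (an even element commutes past an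
even element). [folklore] -/
theorem mul_mul_mul_comm_of_anticommute {A : Type*} [Ring A] {X Y P Q : A}
    (hXP : X * P = -(P * X)) (hXQ : X * Q = -(Q * X)) (hYP : Y * P = -(P * Y))
    (hYQ : Y * Q = -(Q * Y)) : X * Y * (P * Q) = P * Q * (X * Y) := by
  calc X * Y * (P * Q) = X * (Y * P) * Q := by noncomm_ring
    _ = -(X * P * (Y * Q)) := by rw [hYP]; noncomm_ring
    _ = -(P * X * (Q * Y)) := by rw [hXP, hYQ]; noncomm_ring
    _ = -(P * (X * Q) * Y) := by noncomm_ring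
    _ = P * Q * (X * Y) := by rw [hXQ]; noncomm_ring

variable {ωu ωd : U → ι} (hωu : Function.Injective ωu) (hωd : Function.Injective ωd)
  (hdis : ∀ u v, ωu u ≠ ωd v) (φ : J → U → ℝ)
  (hON : ∀ j j', ∑ u, φ j u * φ j' u = if j = j' then 1 else 0)

omit [DecidableEq U] [DecidableEq J] in
include hdis in
/-- The `↑` and `↓` block modes are orthogonal (disjoint orbital supports). [folklore] -/
theorem star_modeUp_dotProduct_modeDown (j j' : J) :
    star (Function.extend ωu (fun u => ((φ j u : ℝ) : ℂ)) 0) ⬝ᵥ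
      Function.extend ωd (fun u => ((φ j' u : ℝ) : ℂ)) 0 = 0 :=
  star_extend_dotProduct_extend_of_disjoint hdis _ _

omit [DecidableEq U] [DecidableEq J] in
include hdis in
/-- The `↓` and `↑` block modes are orthogonal (disjoint orbital supports). [folklore] -/
theorem star_modeDown_dotProduct_modeUp (j j' : J) :
    star (Function.extend ωd (fun u => ((φ j u : ℝ) : ℂ)) 0) ⬝ᵥ
      Function.extend ωu (fun u => ((φ j' u : ℝ) : ℂ)) 0 = 0 :=
  star_extend_dotProduct_extend_of_disjoint (fun u v h => hdis v u h.symm) _ _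

omit [DecidableEq U] [DecidableEq J] in
include hdis in
/-- `b_j† b_j = n_↓(φ_j) n_↑(φ_j)` for the block pair `b_j = c_↑(φ_j) c_↓(φ_j)`.
von Delft–Ralph (2001) §4.2.3. [folklore] -/
theorem conjTranspose_pair_mul_self (j : J) :
    (annihilate (Function.extend ωu (fun u => ((φ j u : ℝ) : ℂ)) 0) *
        annihilate (Function.extend ωd (fun u => ((φ j u : ℝ) : ℂ)) 0))ᴴ *
      (annihilate (Function.extend ωu (fun u => ((φ j u : ℝ) : ℂ)) 0) *
        annihilate (Function.extend ωd (fun u => ((φ j u : ℝ) : ℂ)) 0)) =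
      numberMode (Function.extend ωd (fun u => ((φ j u : ℝ) : ℂ)) 0) *
        numberMode (Function.extend ωu (fun u => ((φ j u : ℝ) : ℂ)) 0) :=
  pair_conjTranspose_mul_pair (star_modeDown_dotProduct_modeUp hdis φ j j)

include hωu hωd hdis hON in
/-- `b_j b_j† = (1 - n_↓(φ_j))(1 - n_↑(φ_j))`. von Delft–Ralph (2001) §4.2.3. [folklore] -/
theorem pair_mul_conjTranspose_self (j : J) :
    annihilate (Function.extend ωu (fun u => ((φ j u : ℝ) : ℂ)) 0) *
        annihilate (Function.extend ωd (fun u => ((φ j u : ℝ) : ℂ)) 0) *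
      (annihilate (Function.extend ωu (fun u => ((φ j u : ℝ) : ℂ)) 0) *
        annihilate (Function.extend ωd (fun u => ((φ j u : ℝ) : ℂ)) 0))ᴴ =
      (1 - numberMode (Function.extend ωd (fun u => ((φ j u : ℝ) : ℂ)) 0)) *
        (1 - numberMode (Function.extend ωu (fun u => ((φ j u : ℝ) : ℂ)) 0)) := by
  set fu := Function.extend ωu (fun u => ((φ j u : ℝ) : ℂ)) 0 with hfu
  set fd := Function.extend ωd (fun u => ((φ j u : ℝ) : ℂ)) 0 with hfd
  have hu1 : star fu ⬝ᵥ fu = 1 := star_mode_dotProduct_self hωu φ hON j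
  have hd1 : star fd ⬝ᵥ fd = 1 := star_mode_dotProduct_self hωd φ hON j
  have hud : star fu ⬝ᵥ fd = 0 := star_modeUp_dotProduct_modeDown hdis φ j j
  have e1 : annihilate fd * create fd = 1 - numberMode fd := by
    rw [annihilate_mul_create_of_unit hd1, numberMode]
  have e2 : annihilate fu * create fu = 1 - numberMode fu := by
    rw [annihilate_mul_create_of_unit hu1, numberMode]
  have e3 : annihilate fu * numberMode fd = numberMode fd * annihilate fu :=
    annihilate_mul_numberMode_of_orthogonal hud
  rw [conjTranspose_mul, annihilate_conjTranspose, annihilate_conjTranspose]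
  calc annihilate fu * annihilate fd * (create fd * create fu)
      = annihilate fu * (annihilate fd * create fd) * create fu := by noncomm_ring
    _ = annihilate fu * (1 - numberMode fd) * create fu := by rw [e1]
    _ = annihilate fu * create fu - annihilate fu * numberMode fd * create fu := by noncomm_ring
    _ = (1 - numberMode fu) - numberMode fd * annihilate fu * create fu := by rw [e3, e2]
    _ = (1 - numberMode fu) - numberMode fd * (annihilate fu * create fu) := by noncomm_ring
    _ = (1 - numberMode fu) - numberMode fd * (1 - numberMode fu) := by rw [e2]
    _ = (1 - numberMode fd) * (1 - numberMode fu) := by noncomm_ring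

include hωu hωd hdis hON in
/-- `[b_j†, b_{j'}] = 0` for `j ≠ j'`: `b_j† b_{j'} = b_{j'} b_j†` (four anticommutations of
orthogonal modes). von Delft–Ralph (2001) §4.2.3. [folklore] -/
theorem conjTranspose_pair_mul_pair_of_ne {j j' : J} (h : j ≠ j') :
    (annihilate (Function.extend ωu (fun u => ((φ j u : ℝ) : ℂ)) 0) *
        annihilate (Function.extend ωd (fun u => ((φ j u : ℝ) : ℂ)) 0))ᴴ *
      (annihilate (Function.extend ωu (fun u => ((φ j' u : ℝ) : ℂ)) 0) *
        annihilate (Function.extend ωd (fun u => ((φ j' u : ℝ) : ℂ)) 0)) =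
      annihilate (Function.extend ωu (fun u => ((φ j' u : ℝ) : ℂ)) 0) *
        annihilate (Function.extend ωd (fun u => ((φ j' u : ℝ) : ℂ)) 0) *
      (annihilate (Function.extend ωu (fun u => ((φ j u : ℝ) : ℂ)) 0) *
        annihilate (Function.extend ωd (fun u => ((φ j u : ℝ) : ℂ)) 0))ᴴ := by
  rw [conjTranspose_mul, annihilate_conjTranspose, annihilate_conjTranspose]
  symm
  refine mul_mul_mul_comm_of_anticommute ?_ ?_ ?_ ?_
  · exact annihilate_mul_create_of_orthogonal (star_modeUp_dotProduct_modeDown hdis φ j' j)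
  · exact annihilate_mul_create_of_orthogonal (star_mode_dotProduct_of_ne hωu φ hON (Ne.symm h))
  · exact annihilate_mul_create_of_orthogonal (star_mode_dotProduct_of_ne hωd φ hON (Ne.symm h))
  · exact annihilate_mul_create_of_orthogonal (star_modeDown_dotProduct_modeUp hdis φ j' j)

end PairAlgebra


/-! ### The block orbital maps of the fermionic torus -/

section TorusMaps

variable {L : ℕ} [NeZero L]

omit [NeZero L] in
/-- For `R ≤ L` the block sites `a + u`, `u ∈ [0,R)²`, are pairwise distinct. [folklore] -/
theorem blockSite_injective (a : TorusSite 2 L) {R : ℕ} (hRL : R ≤ L) :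
    Function.Injective fun u : Fin 2 → Fin R => a + fun i => ((u i : ℕ) : ZMod L) := by
  intro u v huv
  have h : (fun i => ((u i : ℕ) : ZMod L)) = fun i => ((v i : ℕ) : ZMod L) := add_left_cancel huv
  funext i
  have hi := congrFun h i
  have hu : (u i : ℕ) < L := (u i).isLt.trans_le hRL
  have hv : (v i : ℕ) < L := (v i).isLt.trans_le hRL
  have := (ZMod.natCast_eq_natCast_iff' (u i) (v i) L).1 hi
  rw [Nat.mod_eq_of_lt hu, Nat.mod_eq_of_lt hv] at this
  exact Fin.ext this

/-- The block orbital maps `u ↦ (a + u, σ)` are injective for `R ≤ L`. [folklore] -/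
theorem blockOrb_injective (a : TorusSite 2 L) {R : ℕ} (hRL : R ≤ L) (σ : Fin 2) :
    Function.Injective fun u : Fin 2 → Fin R =>
      orb (FermionTorus.ofTorusSite (a + fun i => ((u i : ℕ) : ZMod L))) σ := by
  intro u v huv
  have h1 := congrArg (fun o : Orb (FermionTorus 2 L) => (ofLex o).1) huv
  simp only [orb, ofLex_toLex] at h1
  exact blockSite_injective a hRL (FermionTorus.equivTorusSite.symm.injective h1)

omit [NeZero L] in
/-- Orbitals of different spin are different. [folklore] -/
theorem orb_ne_of_spin_ne (x y : FermionTorus 2 L) : orb x 0 ≠ orb y 1 := fun h => by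
  have h1 := congrArg (fun o : Orb (FermionTorus 2 L) => (ofLex o).2) h
  simp only [orb, ofLex_toLex] at h1
  exact absurd h1 (by decide)

end TorusMaps

/-! ### Registered stub: the pair expansion for the torus block maps -/

section StubA

open Classical

/-- **Registered stub** (`stub_coarseBlockModesPairExpansion`, crux stmt-HubbardSuperconductivity-18534):
the pair expansion `Σ_{u,v} K(u,v) c_{a+u,↑} c_{a+v,↓} = Σ_j κ_j c_↑(φ_j) c_↓(φ_j)` for the block
modes of the fermionic torus, under the spectral hypothesis `K = Σ_j κ_j φ_j φ_jᵀ`.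
Bardeen–Cooper–Schrieffer (1957) §II. [folklore] -/
theorem stub_coarseBlockModesPairExpansion :
    ∀ (L : ℕ) [NeZero L] (a : TorusSite 2 L) (R : ℕ), R ≤ L →
      ∀ (φ : (Fin 2 → Fin R) → (Fin 2 → Fin R) → ℝ) (K : (Fin 2 → Fin R) → (Fin 2 → Fin R) → ℝ)
        (κ : (Fin 2 → Fin R) → ℝ), (∀ u v, K u v = ∑ j, κ j * (φ j u * φ j v)) →
        (∑ u : Fin 2 → Fin R, ∑ v : Fin 2 → Fin R, (K u v : ℂ) •
          (annihilation (orb (FermionTorus.ofTorusSite (a + fun i => ((u i : ℕ) : ZMod L))) 0) *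
            annihilation (orb (FermionTorus.ofTorusSite (a + fun i => ((v i : ℕ) : ZMod L))) 1))) =
        ∑ j : Fin 2 → Fin R, (κ j : ℂ) •
          (annihilate (Function.extend (fun u : Fin 2 → Fin R =>
              orb (FermionTorus.ofTorusSite (a + fun i => ((u i : ℕ) : ZMod L))) 0)
              (fun u => ((φ j u : ℝ) : ℂ)) 0) *
            annihilate (Function.extend (fun u : Fin 2 → Fin R =>
              orb (FermionTorus.ofTorusSite (a + fun i => ((u i : ℕ) : ZMod L))) 1)
              (fun u => ((φ j u : ℝ) : ℂ)) 0)) := by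
  intro L _ a R hRL φ K κ hK
  have h := sum_smul_pair_eq (blockOrb_injective a hRL 0) (blockOrb_injective a hRL 1) φ K κ hK
  beta_reduce at h
  exact h

end StubA

end Summit.HubbardSuperconductivity.HubbardSuperconductivity.Theorems.CoarseTightness

end
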